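import Literature.NumberTheory.GaloisRepresentations.AbsIntegersEquiv
import Literature.NumberTheory.GaloisRepresentations.FrobeniusDensityTheorem
import HarnessLib

/-!
# Places of an extension `M/F`, primes of `\bar ℤ`, and Frobenius elements under `Γ_M → Γ_F`
(trunk GalRep; pure proofs — the bookkeeping behind the Frobenius class of an induced
representation at a prime of prime residue-degree pattern)

Let `M/F` be an extension of number fields, `ι : \bar ℤ_F ≅ \bar ℤ_M` the ring isomorphism of
absolute integers induced by the chosen embedding `F̄ → M̄` (`AbsIntegersEquiv`), and
`res : Γ_M → Γ_F` the restriction (`absGaloisRestrict`), so that `ι(res γ • x) = γ • ι x`.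
For a prime `𝔔` of `\bar ℤ_M` above a place `w` of `M` above the place `v` of `F`, the prime
`𝔓 = ι⁻¹ 𝔔` of `\bar ℤ_F` lies above `v`, and conversely every prime `𝔓 ∣ v` is `ι⁻¹ 𝔔` for a
unique `𝔔`, which lies above a unique place `w(𝔓) ∣ v` of `M`.  This file proves the dictionary
between Frobenius elements of `Γ_F` at `𝔓` and Frobenius elements of `Γ_M` at `𝔔`
(Neukirch, *Algebraic Number Theory*, Ch. I §9, (9.4)–(9.5): under restriction the Frobenius of
`𝔔 ∣ w` maps to `Frob_𝔓^{f(w|v)}`), and, for `M/F` **Galois of prime degree `l`**, the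
description of the places above an unramified `v` in terms of one Frobenius `Φ` at one prime
`𝔓₀ ∣ v` (Neukirch I (9.3)/(9.5); Marcus, *Number Fields*, Ch. 4, Thm. 28–29 and 32):

* `isArithFrobAt_of_absGaloisRestrict_eq_pow`: if `res τ = Φ^{f(w|v)}` with `Φ` an arithmetic
  Frobenius at `ι⁻¹ 𝔔`, then `τ` is an arithmetic Frobenius of `Γ_M` at `𝔔`;
  `isArithFrobAt_absGaloisRestrict_of_inertiaDeg_eq_one` (converse for `f = 1`);
  `inertiaDeg_eq_one_of_isArithFrobAt_absGaloisRestrict` (a Frobenius in `res(Γ_M)` forces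
  `f(w|v) = 1`).
* `exists_mem_primesAbove_comap_eq_smul`: translating `𝔓` by an element of `res(Γ_M)` does not
  change the place `w(𝔓)` of `M` below `ι 𝔓`.
* `IsGalois`, prime degree `l`, `v` unramified in `M` (`Algebra.IsUnramifiedIn`):
  `placesOver_dichotomy_of_prime` — either all `l` places above `v` have `f = 1`, or there is a
  single one with `f = l`; `exists_places_split_of_mem_range` — if some Frobenius above `v` lies
  in `H = res(Γ_M)` (normal of index `l`) and `c ∉ H`, the places above `v` are exactly the
  pairwise distinct `w(cⁱ 𝔓₀)`, `i < l`, each carrying a Frobenius `τᵢ ∈ Γ_M` with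
  `res τᵢ = cⁱ Φ c⁻ⁱ`; `exists_place_inert_of_not_mem_range` — if the Frobenius is not in `H`,
  there is a single place `w ∣ v`, of residue degree `l`, carrying a Frobenius `τ` with
  `res τ = Φ^l`.

These are the Galois-side inputs of the monomial cases of Langlands–Tunnell
(`Automorphic/LanglandsTunnellMonomial`): with Artin reciprocity for a character `ψ` of `Γ_M`
they identify `∏_{w ∣ v} (X^{f(w|v)} - ω_ψ(ϖ_w))` with the characteristic polynomial of
`Ind ψ (Frob_v)`.  No definitions, no named facts; the transitivity of `Γ_F` on the primes above
`v` and the existence of Frobenius elements are the proved theorems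
`exists_smul_eq_of_mem_primesAbove_holds`, `exists_isArithFrobAt_of_mem_primesAbove_holds`
(`IntegralGaloisActionProofs`).

## References

* J. Neukirch, *Algebraic Number Theory* (1999), Ch. I §9, (9.1)–(9.5). [NeukirchANT1999]
* D. A. Marcus, *Number Fields* (2018), Ch. 4, Thm. 28, 29, 32 and the remarks after Thm. 32.
  [Marcus2018]
-/

noncomputable section

open scoped NumberField Pointwise
open NumberField IsDedekindDomain Field

namespace Literature.NumberTheory.GaloisRepresentations

/-! ### Primes of `\bar ℤ_F` and `\bar ℤ_M`, places, residue degrees -/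

section Primes

variable (F M : Type*) [Field F] [Field M] [Algebra F M]

/-- `ι⁻¹ ∘ ι = id` on `\bar ℤ_F` for the isomorphism `ι = absIntegersEquiv F M` (`M/F`
algebraic). [folklore] -/
theorem absIntegersEquiv_symm_comp [Algebra.IsAlgebraic F M] :
    (absIntegersEquiv F M).symm.toRingHom.comp (absIntegersMap F M) = RingHom.id _ := by
  refine RingHom.ext fun x => ?_
  exact (absIntegersEquiv F M).symm_apply_apply x

/-- **Every prime of `\bar ℤ_F` is `ι⁻¹ 𝔔` for a prime `𝔔` of `\bar ℤ_M`** (`M/F` algebraic: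
`ι` is an isomorphism; `𝔔 = ι 𝔓`). [folklore] -/
theorem exists_isPrime_comap_absIntegersMap_eq [Algebra.IsAlgebraic F M]
    (𝔓 : Ideal (absIntegers (𝓞 F) F)) [𝔓.IsPrime] :
    ∃ 𝔔 : Ideal (absIntegers (𝓞 M) M), 𝔔.IsPrime ∧ 𝔔.comap (absIntegersMap F M) = 𝔓 := by
  refine ⟨𝔓.comap (absIntegersEquiv F M).symm.toRingHom, Ideal.comap_isPrime _ 𝔓, ?_⟩
  rw [Ideal.comap_comap, absIntegersEquiv_symm_comp, Ideal.comap_id]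

/-- `𝔔 ↦ ι⁻¹ 𝔔` is injective on ideals of `\bar ℤ_M` (`ι` is onto for `M/F` algebraic).
[folklore] -/
theorem comap_absIntegersMap_injective [Algebra.IsAlgebraic F M] :
    Function.Injective (Ideal.comap (absIntegersMap F M) :
      Ideal (absIntegers (𝓞 M) M) → Ideal (absIntegers (𝓞 F) F)) :=
  Ideal.comap_injective_of_surjective _ (absIntegersMap_surjective F M)

variable {F M}

/-- A prime of `\bar ℤ_M` lies above at most one place of `M`. [folklore] -/
theorem HeightOneSpectrum.eq_of_mem_primesAbove {w w' : HeightOneSpectrum (𝓞 M)}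
    {𝔔 : Ideal (absIntegers (𝓞 M) M)} (h : 𝔔 ∈ w.primesAbove) (h' : 𝔔 ∈ w'.primesAbove) :
    w = w' :=
  HeightOneSpectrum.ext (h.2.over.trans h'.2.over.symm)

variable [NumberField F] [NumberField M]

/-- **`q_w = q_v^{f(w|v)}`** for a place `w` of `M` above the place `v` of `F`
(Neukirch I §8; Mathlib `Ideal.absNorm_eq_pow_inertiaDeg'_of_liesOver`). [folklore] -/
theorem residueCard_eq_residueCard_pow_inertiaDeg {v : HeightOneSpectrum (𝓞 F)}
    {w : HeightOneSpectrum (𝓞 M)} (hw : w.asIdeal.under (𝓞 F) = v.asIdeal) :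
    w.residueCard = v.residueCard ^ w.asIdeal.inertiaDeg (𝓞 F) := by
  haveI : w.asIdeal.LiesOver v.asIdeal := ⟨hw.symm⟩
  haveI : v.asIdeal.IsMaximal := v.isMaximal
  haveI : w.asIdeal.IsMaximal := w.isMaximal
  rw [HeightOneSpectrum.residueCard, HeightOneSpectrum.residueCard,
    Ideal.absNorm_eq_pow_inertiaDeg'_of_liesOver w.asIdeal v.asIdeal v.isPrime v.ne_bot,
    Ideal.inertiaDeg'_eq_inertiaDeg v.asIdeal w.asIdeal]

omit [NumberField M] in
/-- **Powers of Frobenius**: if `Φ` is an arithmetic Frobenius at `𝔓 ∣ v` then `Φ^k` acts on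
`\bar ℤ_F / 𝔓` as `x ↦ x^{q_v^k}`. [folklore] -/
theorem smul_pow_sub_pow_mem_of_isArithFrobAt {v : HeightOneSpectrum (𝓞 F)}
    {𝔓 : Ideal (absIntegers (𝓞 F) F)} (h𝔓 : 𝔓 ∈ v.primesAbove) {Φ : absoluteGaloisGroup F}
    (hΦ : IsArithFrobAt (𝓞 F) Φ 𝔓) (k : ℕ) (x : absIntegers (𝓞 F) F) :
    Φ ^ k • x - x ^ (v.residueCard ^ k) ∈ 𝔓 := by
  have hΦ' := (HeightOneSpectrum.isArithFrobAt_iff_of_mem_primesAbove h𝔓 Φ).mp hΦ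
  induction k generalizing x with
  | zero => simp
  | succ k ih =>
    rw [pow_succ', mul_smul, pow_succ, pow_mul]
    have h1 := hΦ' (Φ ^ k • x)
    have h2 : (Φ ^ k • x) ^ v.residueCard - (x ^ v.residueCard ^ k) ^ v.residueCard ∈ 𝔓 := by
      rw [← Ideal.Quotient.eq_zero_iff_mem, map_sub, map_pow, map_pow, sub_eq_zero]
      congr 1
      rw [← sub_eq_zero, ← map_sub, Ideal.Quotient.eq_zero_iff_mem]
      exact ih x
    have := add_mem h1 h2
    rwa [sub_add_sub_cancel] at this

/-! ### Frobenius elements under `res : Γ_M → Γ_F` -/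

/-- **From `Γ_F` to `Γ_M`** (Neukirch I (9.4)–(9.5)): let `𝔔 ∣ w ∣ v` and let `Φ ∈ Γ_F` be an
arithmetic Frobenius at `ι⁻¹ 𝔔 ∣ v`.  If `τ ∈ Γ_M` restricts to `Φ^{f(w|v)}`, then `τ` is an
arithmetic Frobenius of `M` at `𝔔` (`τ` acts on `\bar ℤ_M / 𝔔` as `x ↦ x^{q_v^f} = x^{q_w}`).
[folklore] -/
theorem isArithFrobAt_of_absGaloisRestrict_eq_pow [Algebra.IsAlgebraic F M]
    {v : HeightOneSpectrum (𝓞 F)} {w : HeightOneSpectrum (𝓞 M)}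
    (hw : w.asIdeal.under (𝓞 F) = v.asIdeal) {𝔔 : Ideal (absIntegers (𝓞 M) M)}
    (h𝔔 : 𝔔 ∈ w.primesAbove) {Φ : absoluteGaloisGroup F}
    (hΦ : IsArithFrobAt (𝓞 F) Φ (𝔔.comap (absIntegersMap F M))) {τ : absoluteGaloisGroup M}
    (hτ : absGaloisRestrict F M τ = Φ ^ w.asIdeal.inertiaDeg (𝓞 F)) :
    IsArithFrobAt (𝓞 M) τ 𝔔 := by
  rw [HeightOneSpectrum.isArithFrobAt_iff_of_mem_primesAbove h𝔔,
    ← forall_smul_sub_pow_mem_comap_iff F M 𝔔 τ w.residueCard]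
  intro x
  rw [hτ, residueCard_eq_residueCard_pow_inertiaDeg hw]
  exact smul_pow_sub_pow_mem_of_isArithFrobAt (comap_absIntegersMap_mem_primesAbove hw h𝔔) hΦ _ x

/-- **From `Γ_M` to `Γ_F` at a place of residue degree one**: if `f(w|v) = 1` and `τ ∈ Γ_M` is an
arithmetic Frobenius at `𝔔 ∣ w`, then `res τ` is an arithmetic Frobenius of `F` at `ι⁻¹ 𝔔`
(`q_w = q_v`). [folklore] -/
theorem isArithFrobAt_absGaloisRestrict_of_inertiaDeg_eq_one [Algebra.IsAlgebraic F M]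
    {v : HeightOneSpectrum (𝓞 F)} {w : HeightOneSpectrum (𝓞 M)}
    (hw : w.asIdeal.under (𝓞 F) = v.asIdeal) {𝔔 : Ideal (absIntegers (𝓞 M) M)}
    (h𝔔 : 𝔔 ∈ w.primesAbove) {τ : absoluteGaloisGroup M} (hτ : IsArithFrobAt (𝓞 M) τ 𝔔)
    (hf : w.asIdeal.inertiaDeg (𝓞 F) = 1) :
    IsArithFrobAt (𝓞 F) (absGaloisRestrict F M τ) (𝔔.comap (absIntegersMap F M)) := by
  rw [HeightOneSpectrum.isArithFrobAt_iff_of_mem_primesAbove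
      (comap_absIntegersMap_mem_primesAbove hw h𝔔),
    forall_smul_sub_pow_mem_comap_iff F M 𝔔 τ v.residueCard]
  have hq : w.residueCard = v.residueCard := by
    rw [residueCard_eq_residueCard_pow_inertiaDeg hw, hf, pow_one]
  rw [← hq]
  exact (HeightOneSpectrum.isArithFrobAt_iff_of_mem_primesAbove h𝔔 τ).mp hτ

/-- **A Frobenius in `res(Γ_M)` forces residue degree one** (Marcus Ch. 4, Thm. 29: the
decomposition field): if `res τ`, `τ ∈ Γ_M`, is an arithmetic Frobenius of `F` at `ι⁻¹ 𝔔` with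
`𝔔 ∣ w ∣ v`, then `f(w|v) = 1` — `τ` fixes `𝓞 M` and acts on `\bar ℤ_M / 𝔔 ⊇ 𝓞 M / w` as
`x ↦ x^{q_v}`, so `#(𝓞 M / w) ≤ q_v`. [cite: Marcus2018, Ch. 4, Thm. 29] -/
theorem inertiaDeg_eq_one_of_isArithFrobAt_absGaloisRestrict [Algebra.IsAlgebraic F M]
    {v : HeightOneSpectrum (𝓞 F)} {w : HeightOneSpectrum (𝓞 M)}
    (hw : w.asIdeal.under (𝓞 F) = v.asIdeal) {𝔔 : Ideal (absIntegers (𝓞 M) M)}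
    (h𝔔 : 𝔔 ∈ w.primesAbove) {τ : absoluteGaloisGroup M}
    (hΦ : IsArithFrobAt (𝓞 F) (absGaloisRestrict F M τ) (𝔔.comap (absIntegersMap F M))) :
    w.asIdeal.inertiaDeg (𝓞 F) = 1 := by
  haveI : Module.Finite (𝓞 F) (𝓞 M) := IsIntegralClosure.finite (𝓞 F) F M (𝓞 M)
  haveI : w.asIdeal.IsMaximal := w.isMaximal
  haveI : v.asIdeal.IsMaximal := v.isMaximal
  haveI : w.asIdeal.LiesOver v.asIdeal := ⟨hw.symm⟩
  haveI : Finite (𝓞 F ⧸ v.asIdeal) := Ideal.finiteQuotientOfFreeOfNeBot _ v.ne_bot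
  have hq1 : 1 < Nat.card (𝓞 F ⧸ v.asIdeal) := by
    rw [← HeightOneSpectrum.residueCard_eq_card_quotient]; exact v.one_lt_residueCard
  have hτ := (HeightOneSpectrum.isArithFrobAt_iff_of_mem_primesAbove
    (comap_absIntegersMap_mem_primesAbove hw h𝔔) _).mp hΦ
  rw [forall_smul_sub_pow_mem_comap_iff F M 𝔔 τ v.residueCard] at hτ
  refine inertiaDeg_eq_one_of_forall_pow_sub_mem' v.asIdeal w.asIdeal hq1 fun y => ?_
  rw [← HeightOneSpectrum.residueCard_eq_card_quotient, h𝔔.2.over, Ideal.under, Ideal.mem_comap,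
    map_sub, map_pow]
  have h1 := hτ (algebraMap (𝓞 M) (absIntegers (𝓞 M) M) y)
  rw [smul_algebraMap] at h1
  rw [← Ideal.neg_mem_iff, neg_sub]
  exact h1

/-! ### Translating `𝔓` inside `res(Γ_M)` does not move the place below `ι 𝔓` -/

omit [NumberField F] [NumberField M] in
/-- If `𝔔 ∣ w` and `h = res δ ∈ res(Γ_M)`, then `h • ι⁻¹ 𝔔 = ι⁻¹ (δ • 𝔔)` with `δ • 𝔔 ∣ w`: the
place of `M` below the prime of `\bar ℤ_M` corresponding to `h • 𝔓` is the same as for `𝔓`.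
[folklore] -/
theorem exists_mem_primesAbove_comap_eq_smul {w : HeightOneSpectrum (𝓞 M)}
    {𝔔 : Ideal (absIntegers (𝓞 M) M)} (h𝔔 : 𝔔 ∈ w.primesAbove) {h : absoluteGaloisGroup F}
    (hh : h ∈ (absGaloisRestrict F M).range) :
    ∃ 𝔔' ∈ w.primesAbove,
      𝔔'.comap (absIntegersMap F M) = h • 𝔔.comap (absIntegersMap F M) := by
  obtain ⟨δ, rfl⟩ := hh
  exact ⟨δ • 𝔔, smul_mem_primesAbove h𝔔 δ,
    comap_absIntegersMap_smul F M δ 𝔔⟩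

omit [NumberField F] [NumberField M] in
/-- **The place below `ι(g • 𝔓₀)` for every prime `𝔓₀ ∣ v` and `g ∈ Γ_F`**: there are a prime
`𝔔` of `\bar ℤ_M` with `ι⁻¹ 𝔔 = g • 𝔓₀` and a place `w ∣ v` of `M` with `𝔔 ∣ w`. [folklore] -/
theorem exists_place_comap_eq_smul [Algebra.IsAlgebraic F M] {v : HeightOneSpectrum (𝓞 F)}
    {𝔓₀ : Ideal (absIntegers (𝓞 F) F)} (h𝔓₀ : 𝔓₀ ∈ v.primesAbove) (g : absoluteGaloisGroup F) :
    ∃ (𝔔 : Ideal (absIntegers (𝓞 M) M)) (w : HeightOneSpectrum (𝓞 M)),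
      𝔔.comap (absIntegersMap F M) = g • 𝔓₀ ∧ w.asIdeal.under (𝓞 F) = v.asIdeal ∧
        𝔔 ∈ w.primesAbove := by
  have hg := smul_mem_primesAbove h𝔓₀ g
  haveI := hg.1
  obtain ⟨𝔔, h𝔔prime, h𝔔⟩ := exists_isPrime_comap_absIntegersMap_eq F M (g • 𝔓₀)
  haveI := h𝔔prime
  obtain ⟨w, hw, h𝔔w, -⟩ :=
    exists_heightOneSpectrum_of_comap_absIntegersMap_mem_primesAbove (K := F) (M := M)
      (𝔔 := 𝔔) (h𝔔.symm ▸ hg)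
  exact ⟨𝔔, w, h𝔔, hw, h𝔔w⟩

/-- **Every place above `v` is reached**: for `w ∣ v` and a prime `𝔓₀ ∣ v` there is `g ∈ Γ_F`
and a prime `𝔔 ∣ w` of `\bar ℤ_M` with `ι⁻¹ 𝔔 = g • 𝔓₀` (primes above `w` exist, and `Γ_F` is
transitive on the primes above `v`). [folklore] -/
theorem exists_smul_eq_comap_of_under_eq {v : HeightOneSpectrum (𝓞 F)}
    {𝔓₀ : Ideal (absIntegers (𝓞 F) F)} (h𝔓₀ : 𝔓₀ ∈ v.primesAbove) {w : HeightOneSpectrum (𝓞 M)}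
    (hw : w.asIdeal.under (𝓞 F) = v.asIdeal) :
    ∃ (g : absoluteGaloisGroup F) (𝔔 : Ideal (absIntegers (𝓞 M) M)), 𝔔 ∈ w.primesAbove ∧
      𝔔.comap (absIntegersMap F M) = g • 𝔓₀ := by
  obtain ⟨𝔔, h𝔔⟩ := HeightOneSpectrum.primesAbove_nonempty w
  obtain ⟨g, hg⟩ := HeightOneSpectrum.exists_smul_eq_of_mem_primesAbove_holds h𝔓₀
    (comap_absIntegersMap_mem_primesAbove hw h𝔔)
  exact ⟨g, 𝔔, h𝔔, hg.symm⟩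

end Primes

/-! ### A normal subgroup of prime index: right cosets of the powers of a non-element -/

section PrimeIndex

variable {G : Type*} [Group G]

/-- If `H ◁ G` has prime index `l` and `c ∉ H`, every `g ∈ G` is `h cⁱ` with `h ∈ H`, `i < l`
(`G/H` is cyclic of order `l`, generated by the class of `c`). [folklore] -/
theorem exists_mem_mul_pow_eq_of_prime_index {H : Subgroup G} [H.Normal] {l : ℕ} (hl : l.Prime)
    (hHi : H.index = l) {c : G} (hc : c ∉ H) (g : G) : ∃ i < l, ∃ h ∈ H, g = h * c ^ i := by
  haveI : Fact l.Prime := ⟨hl⟩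
  have hcard : Nat.card (G ⧸ H) = l := by rw [← Subgroup.index_eq_card, hHi]
  haveI : Finite (G ⧸ H) := Nat.finite_of_card_ne_zero (by rw [hcard]; exact hl.ne_zero)
  set cb : G ⧸ H := QuotientGroup.mk c with hcb
  have hcb1 : cb ≠ 1 := fun h => hc ((QuotientGroup.eq_one_iff c).mp h)
  have hord : orderOf cb = l := by
    have hdvd : orderOf cb ∣ l := hcard ▸ orderOf_dvd_natCard cb
    rcases (Nat.dvd_prime hl).mp hdvd with h1 | h1
    · exact absurd (orderOf_eq_one_iff.mp h1) hcb1
    · exact h1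
  have hgen : ∀ x : G ⧸ H, x ∈ Subgroup.zpowers cb := by
    have htop : Subgroup.zpowers cb = ⊤ := by
      apply Subgroup.eq_top_of_card_eq
      rw [Nat.card_zpowers, hord, hcard]
    intro x
    rw [htop]
    exact Subgroup.mem_top x
  obtain ⟨n, hn⟩ : ∃ n : ℕ, cb ^ n = QuotientGroup.mk g :=
    mem_powers_iff_mem_zpowers.mpr (hgen (QuotientGroup.mk g))
  refine ⟨n % l, Nat.mod_lt n hl.pos, g * (c ^ (n % l))⁻¹, ?_, by rw [inv_mul_cancel_right]⟩
  rw [← QuotientGroup.eq_one_iff, QuotientGroup.mk_mul, QuotientGroup.mk_inv, QuotientGroup.mk_pow,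
    ← hcb, ← hn, mul_inv_eq_one, ← hord, pow_mod_orderOf]

end PrimeIndex

/-! ### Galois extensions of prime degree: the places above an unramified place -/

section PrimeDegree

variable {F M : Type*} [Field F] [NumberField F] [Field M] [NumberField M] [Algebra F M]

/-- At a prime unramified in the Galois extension `M/F` the common ramification index is `1`
(Mathlib `Ideal.ramificationIdx_eq_one_iff`, `Ideal.ramificationIdxIn_eq_ramificationIdx`).
[folklore] -/
theorem ramificationIdxIn_eq_one_of_isUnramifiedIn [IsGalois F M] {v : HeightOneSpectrum (𝓞 F)}
    (hunr : Algebra.IsUnramifiedIn (𝓞 M) v.asIdeal) : v.asIdeal.ramificationIdxIn (𝓞 M) = 1 := by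
  haveI : v.asIdeal.IsMaximal := v.isMaximal
  haveI : IsGaloisGroup (M ≃ₐ[F] M) (𝓞 F) (𝓞 M) := IsGaloisGroup.of_isFractionRing _ _ _ F M
  obtain ⟨Q, hQmax, hQover⟩ :=
    Ideal.exists_maximal_ideal_liesOver_of_isIntegral (S := 𝓞 M) v.asIdeal
  haveI := hQmax.isPrime
  haveI := hQover
  rw [Ideal.ramificationIdxIn_eq_ramificationIdx v.asIdeal Q (M ≃ₐ[F] M)]
  exact Ideal.ramificationIdx_eq_one_iff.mpr (hunr Q hQmax.isPrime hQover)

omit [NumberField F] [NumberField M] in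
/-- `#{w | v} = #(primes of 𝓞 M over v)`. [folklore] -/
theorem natCard_placesOver_eq_ncard (v : HeightOneSpectrum (𝓞 F)) :
    Nat.card {w : HeightOneSpectrum (𝓞 M) // w.under (𝓞 F) = v} =
      (v.asIdeal.primesOver (𝓞 M)).ncard := by
  rw [← Nat.card_coe_set_eq]
  refine Nat.card_congr ⟨fun w => ⟨w.1.asIdeal, w.1.isPrime,
      ⟨(congrArg HeightOneSpectrum.asIdeal w.2).symm⟩⟩,
    fun P => ⟨⟨P.1, P.2.1, Ideal.ne_bot_of_mem_primesOver v.ne_bot P.2⟩,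
      HeightOneSpectrum.ext P.2.2.over.symm⟩, fun w => ?_, fun P => ?_⟩
  · rfl
  · rfl

/-- **Fundamental identity at an unramified prime of a Galois extension**:
`#{w | v} · f(w₀|v) = [M : F]` for any `w₀ ∣ v` (all residue degrees above `v` agree; Neukirch I
(9.2); Mathlib `Ideal.ncard_primesOver_mul_ramificationIdxIn_mul_inertiaDegIn`). [folklore] -/
theorem natCard_placesOver_mul_inertiaDeg [IsGalois F M] {v : HeightOneSpectrum (𝓞 F)}
    (hunr : Algebra.IsUnramifiedIn (𝓞 M) v.asIdeal) {w₀ : HeightOneSpectrum (𝓞 M)}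
    (hw₀ : w₀.under (𝓞 F) = v) :
    Nat.card {w : HeightOneSpectrum (𝓞 M) // w.under (𝓞 F) = v} * w₀.asIdeal.inertiaDeg (𝓞 F) =
      Module.finrank F M := by
  haveI : v.asIdeal.IsMaximal := v.isMaximal
  haveI : IsGaloisGroup (M ≃ₐ[F] M) (𝓞 F) (𝓞 M) := IsGaloisGroup.of_isFractionRing _ _ _ F M
  haveI : w₀.asIdeal.LiesOver v.asIdeal := ⟨(congrArg HeightOneSpectrum.asIdeal hw₀).symm⟩
  have h := Ideal.ncard_primesOver_mul_ramificationIdxIn_mul_inertiaDegIn v.asIdeal (𝓞 M)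
    (M ≃ₐ[F] M)
  rw [ramificationIdxIn_eq_one_of_isUnramifiedIn hunr, one_mul,
    IsGaloisGroup.card_eq_finrank (M ≃ₐ[F] M) F M,
    Ideal.inertiaDegIn_eq_inertiaDeg v.asIdeal w₀.asIdeal (M ≃ₐ[F] M)] at h
  rwa [natCard_placesOver_eq_ncard]

/-- **Prime degree dichotomy** (Neukirch I (9.3); Marcus Ch. 4, Thm. 28 ff.): in a Galois
extension of prime degree `l`, an unramified `v` either splits completely (`l` places above it,
all of residue degree `1`) or is inert (one place, of residue degree `l`). [folklore] -/
theorem placesOver_dichotomy_of_prime [IsGalois F M] (hl : (Module.finrank F M).Prime)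
    {v : HeightOneSpectrum (𝓞 F)} (hunr : Algebra.IsUnramifiedIn (𝓞 M) v.asIdeal) :
    (Nat.card {w : HeightOneSpectrum (𝓞 M) // w.under (𝓞 F) = v} = Module.finrank F M ∧
        ∀ w : HeightOneSpectrum (𝓞 M), w.under (𝓞 F) = v → w.asIdeal.inertiaDeg (𝓞 F) = 1) ∨
      (Nat.card {w : HeightOneSpectrum (𝓞 M) // w.under (𝓞 F) = v} = 1 ∧
        ∀ w : HeightOneSpectrum (𝓞 M), w.under (𝓞 F) = v →
          w.asIdeal.inertiaDeg (𝓞 F) = Module.finrank F M) := by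
  set N := Nat.card {w : HeightOneSpectrum (𝓞 M) // w.under (𝓞 F) = v} with hN
  -- all residue degrees agree; pick one place above `v`
  haveI : v.asIdeal.IsMaximal := v.isMaximal
  obtain ⟨Q, hQmax, hQover⟩ :=
    Ideal.exists_maximal_ideal_liesOver_of_isIntegral (S := 𝓞 M) v.asIdeal
  haveI := hQmax.isPrime
  set w₀ : HeightOneSpectrum (𝓞 M) :=
    ⟨Q, hQmax.isPrime, Ideal.ne_bot_of_mem_primesOver v.ne_bot ⟨hQmax.isPrime, hQover⟩⟩ with hw₀def
  have hw₀ : w₀.under (𝓞 F) = v := HeightOneSpectrum.ext hQover.over.symm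
  have hf : ∀ w : HeightOneSpectrum (𝓞 M), w.under (𝓞 F) = v →
      w.asIdeal.inertiaDeg (𝓞 F) = w₀.asIdeal.inertiaDeg (𝓞 F) := by
    intro w hw
    have h1 := natCard_placesOver_mul_inertiaDeg hunr hw
    have h2 := natCard_placesOver_mul_inertiaDeg hunr hw₀
    have hpos : 0 < N := by
      rw [hN, Nat.card_pos_iff]
      exact ⟨⟨⟨w₀, hw₀⟩⟩, (finite_setOf_under_eq (M := M) v).to_subtype⟩
    exact Nat.eq_of_mul_eq_mul_left hpos (h1.trans h2.symm)
  have hmul := natCard_placesOver_mul_inertiaDeg hunr hw₀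
  have hdvd : w₀.asIdeal.inertiaDeg (𝓞 F) ∣ Module.finrank F M := Dvd.intro_left _ hmul
  rcases (Nat.dvd_prime hl).mp hdvd with h1 | h1
  · left
    rw [h1, mul_one] at hmul
    exact ⟨hmul, fun w hw => (hf w hw).trans h1⟩
  · right
    rw [h1] at hmul
    have hN1 : N = 1 := by
      have := Nat.eq_of_mul_eq_mul_right hl.pos (hmul.trans (one_mul _).symm)
      exact this
    exact ⟨hN1, fun w hw => (hf w hw).trans h1⟩

/-- The finite set of places above `v` as a `Finset`, with its cardinality. [folklore] -/
theorem card_toFinset_placesOver (v : HeightOneSpectrum (𝓞 F)) :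
    (finite_setOf_under_eq (M := M) v).toFinset.card =
      Nat.card {w : HeightOneSpectrum (𝓞 M) // w.under (𝓞 F) = v} := by
  rw [← Nat.card_eq_card_finite_toFinset]
  rfl

variable [IsGalois F M]

/-- **Split primes, through one Frobenius** (Neukirch I (9.3)–(9.5); Marcus Ch. 4, Thm. 29 and the
remark after Thm. 32).  Let `M/F` be Galois of prime degree `l`, `H = res(Γ_M) ≤ Γ_F` normal of
index `l`, `c ∉ H`, `v` unramified in `M`, `𝔓₀ ∣ v` a prime of `\bar ℤ_F` with an arithmetic
Frobenius `Φ ∈ H`.  Then the places of `M` above `v` are the `l` pairwise distinct places `P i`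
(`i < l`) below `ι(cⁱ 𝔓₀)`, each of residue degree `1`, and each carries a prime `𝔔 i ∣ P i` with
`ι⁻¹(𝔔 i) = cⁱ 𝔓₀` and an arithmetic Frobenius `τ i ∈ Γ_M` with `res (τ i) = cⁱ Φ c⁻ⁱ`. [folklore] -/
theorem exists_places_split_of_mem_range (hl : (Module.finrank F M).Prime)
    (hHn : ((absGaloisRestrict F M).range).Normal)
    (hHi : ((absGaloisRestrict F M).range).index = Module.finrank F M)
    {c : absoluteGaloisGroup F} (hc : c ∉ (absGaloisRestrict F M).range)
    {v : HeightOneSpectrum (𝓞 F)} (hunr : Algebra.IsUnramifiedIn (𝓞 M) v.asIdeal)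
    {𝔓₀ : Ideal (absIntegers (𝓞 F) F)} (h𝔓₀ : 𝔓₀ ∈ v.primesAbove) {Φ : absoluteGaloisGroup F}
    (hΦ : IsArithFrobAt (𝓞 F) Φ 𝔓₀) (hΦH : Φ ∈ (absGaloisRestrict F M).range) :
    ∃ (P : ℕ → HeightOneSpectrum (𝓞 M)) (𝔔 : ℕ → Ideal (absIntegers (𝓞 M) M))
      (τ : ℕ → absoluteGaloisGroup M),
      (∀ i, (P i).under (𝓞 F) = v ∧ 𝔔 i ∈ (P i).primesAbove ∧
        (𝔔 i).comap (absIntegersMap F M) = c ^ i • 𝔓₀ ∧ IsArithFrobAt (𝓞 M) (τ i) (𝔔 i) ∧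
        absGaloisRestrict F M (τ i) = c ^ i * Φ * (c ^ i)⁻¹) ∧
      (∀ w : HeightOneSpectrum (𝓞 M), w.under (𝓞 F) = v → w.asIdeal.inertiaDeg (𝓞 F) = 1) ∧
      (∀ w : HeightOneSpectrum (𝓞 M), w.under (𝓞 F) = v → ∃ i < Module.finrank F M, P i = w) ∧
      (∀ i < Module.finrank F M, ∀ j < Module.finrank F M, P i = P j → i = j) := by
  classical
  haveI := hHn
  set H := (absGaloisRestrict F M).range with hHdef
  set l := Module.finrank F M with hldef
  -- the places, primes and Frobenius elements attached to `cⁱ 𝔓₀`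
  have hdata : ∀ i : ℕ, ∃ (P : HeightOneSpectrum (𝓞 M)) (𝔔 : Ideal (absIntegers (𝓞 M) M))
      (τ : absoluteGaloisGroup M), P.under (𝓞 F) = v ∧ 𝔔 ∈ P.primesAbove ∧
        𝔔.comap (absIntegersMap F M) = c ^ i • 𝔓₀ ∧
        absGaloisRestrict F M τ = c ^ i * Φ * (c ^ i)⁻¹ := by
    intro i
    obtain ⟨𝔔, P, h𝔔, hP, h𝔔P⟩ := exists_place_comap_eq_smul (M := M) h𝔓₀ (c ^ i)
    obtain ⟨τ, hτ⟩ : c ^ i * Φ * (c ^ i)⁻¹ ∈ H := hHn.conj_mem Φ hΦH (c ^ i)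
    exact ⟨P, 𝔔, τ, HeightOneSpectrum.ext hP, h𝔔P, h𝔔, hτ⟩
  choose P 𝔔 τ hPv h𝔔P h𝔔c hτ using hdata
  -- all residue degrees are `1`: the place below `ι 𝔓₀` has a Frobenius in `H`
  have hf1 : ∀ w : HeightOneSpectrum (𝓞 M), w.under (𝓞 F) = v → w.asIdeal.inertiaDeg (𝓞 F) = 1 := by
    rcases placesOver_dichotomy_of_prime hl hunr with ⟨-, h⟩ | ⟨-, h⟩
    · exact h
    · exfalso
      have hP0 : (P 0).asIdeal.under (𝓞 F) = v.asIdeal := congrArg HeightOneSpectrum.asIdeal (hPv 0)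
      have hΦ0 : IsArithFrobAt (𝓞 F) (absGaloisRestrict F M (τ 0))
          ((𝔔 0).comap (absIntegersMap F M)) := by
        rw [hτ 0, h𝔔c 0, pow_zero, one_mul, inv_one, mul_one, one_smul]
        exact hΦ
      have h1 := inertiaDeg_eq_one_of_isArithFrobAt_absGaloisRestrict hP0 (h𝔔P 0) hΦ0
      rw [h (P 0) (hPv 0)] at h1
      exact hl.one_lt.ne' h1
  -- Frobenius at `𝔔 i`
  have hFrob : ∀ i, IsArithFrobAt (𝓞 M) (τ i) (𝔔 i) := by
    intro i
    have hP' : (P i).asIdeal.under (𝓞 F) = v.asIdeal := congrArg HeightOneSpectrum.asIdeal (hPv i)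
    refine isArithFrobAt_of_absGaloisRestrict_eq_pow hP' (h𝔔P i) (Φ := c ^ i * Φ * (c ^ i)⁻¹)
      ?_ ?_
    · rw [h𝔔c i]
      exact hΦ.conj (c ^ i)
    · rw [hf1 _ (hPv i), pow_one, hτ i]
  -- every place above `v` is some `P i`, `i < l`
  have hcover : ∀ w : HeightOneSpectrum (𝓞 M), w.under (𝓞 F) = v → ∃ i < l, P i = w := by
    intro w hw
    have hw' : w.asIdeal.under (𝓞 F) = v.asIdeal := congrArg HeightOneSpectrum.asIdeal hw
    obtain ⟨g, 𝔔w, h𝔔w, hg⟩ := exists_smul_eq_comap_of_under_eq (M := M) h𝔓₀ hw'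
    obtain ⟨i, hi, h, hh, rfl⟩ := exists_mem_mul_pow_eq_of_prime_index hl hHi hc g
    refine ⟨i, hi, ?_⟩
    obtain ⟨𝔔', h𝔔'P, h𝔔'⟩ := exists_mem_primesAbove_comap_eq_smul (F := F) (h𝔔P i) hh
    have hsm : h • c ^ i • 𝔓₀ = (h * c ^ i) • 𝔓₀ := smul_smul h (c ^ i) 𝔓₀
    rw [h𝔔c i, hsm, ← hg] at h𝔔'
    have heq : 𝔔' = 𝔔w := comap_absIntegersMap_injective F M h𝔔'
    rw [heq] at h𝔔'P
    exact HeightOneSpectrum.eq_of_mem_primesAbove h𝔔'P h𝔔w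
  -- the `P i`, `i < l`, are pairwise distinct (`l` of them cover a set of `l` places)
  have hinj : ∀ i < l, ∀ j < l, P i = P j → i = j := by
    set S := (finite_setOf_under_eq (M := M) v).toFinset with hSdef
    have hScard : S.card = l := by
      rw [hSdef, card_toFinset_placesOver]
      rcases placesOver_dichotomy_of_prime hl hunr with ⟨h, -⟩ | ⟨-, h⟩
      · exact h
      · exfalso
        have h1 := hf1 (P 0) (hPv 0)
        rw [h (P 0) (hPv 0)] at h1
        exact hl.one_lt.ne' h1
    have hsub : S ⊆ (Finset.range l).image P := by
      intro w hw
      rw [hSdef, Set.Finite.mem_toFinset, Set.mem_setOf_eq] at hw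
      obtain ⟨i, hi, rfl⟩ := hcover w hw
      exact Finset.mem_image.mpr ⟨i, Finset.mem_range.mpr hi, rfl⟩
    have hcardim : ((Finset.range l).image P).card = (Finset.range l).card := by
      refine le_antisymm Finset.card_image_le ?_
      calc (Finset.range l).card = S.card := by rw [Finset.card_range, hScard]
        _ ≤ ((Finset.range l).image P).card := Finset.card_le_card hsub
    have hinjOn := Finset.card_image_iff.mp hcardim
    intro i hi j hj hij
    exact hinjOn (Finset.mem_coe.mpr (Finset.mem_range.mpr hi))
      (Finset.mem_coe.mpr (Finset.mem_range.mpr hj)) hij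
  exact ⟨P, 𝔔, τ, fun i => ⟨hPv i, h𝔔P i, h𝔔c i, hFrob i, hτ i⟩, hf1, hcover, hinj⟩

/-- **Inert primes, through one Frobenius** (Neukirch I (9.3)–(9.5); Marcus Ch. 4, Thm. 28–29):
with `M/F`, `H`, `v`, `𝔓₀`, `Φ` as in `exists_places_split_of_mem_range`, assume now that the
inertia group of `𝔓₀` lies in `H` and that `Φ ∉ H`.  Then there is exactly one place `w` of `M`
above `v`; it has residue degree `l`, and it carries a prime `𝔔 ∣ w` with `ι⁻¹ 𝔔 = 𝔓₀` and an
arithmetic Frobenius `τ ∈ Γ_M` with `res τ = Φ^l`. [folklore] -/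
theorem exists_place_inert_of_not_mem_range (hl : (Module.finrank F M).Prime)
    (hHn : ((absGaloisRestrict F M).range).Normal)
    (hHi : ((absGaloisRestrict F M).range).index = Module.finrank F M)
    {v : HeightOneSpectrum (𝓞 F)} (hunr : Algebra.IsUnramifiedIn (𝓞 M) v.asIdeal)
    {𝔓₀ : Ideal (absIntegers (𝓞 F) F)} (h𝔓₀ : 𝔓₀ ∈ v.primesAbove)
    (hI : 𝔓₀.inertia (absoluteGaloisGroup F) ≤ (absGaloisRestrict F M).range)
    {Φ : absoluteGaloisGroup F} (hΦ : IsArithFrobAt (𝓞 F) Φ 𝔓₀)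
    (hΦH : Φ ∉ (absGaloisRestrict F M).range) :
    ∃ (w : HeightOneSpectrum (𝓞 M)) (𝔔 : Ideal (absIntegers (𝓞 M) M)) (τ : absoluteGaloisGroup M),
      w.under (𝓞 F) = v ∧ (∀ w' : HeightOneSpectrum (𝓞 M), w'.under (𝓞 F) = v → w' = w) ∧
      w.asIdeal.inertiaDeg (𝓞 F) = Module.finrank F M ∧ 𝔔 ∈ w.primesAbove ∧
      𝔔.comap (absIntegersMap F M) = 𝔓₀ ∧ IsArithFrobAt (𝓞 M) τ 𝔔 ∧
      absGaloisRestrict F M τ = Φ ^ Module.finrank F M := by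
  classical
  haveI := hHn
  set H := (absGaloisRestrict F M).range with hHdef
  set l := Module.finrank F M with hldef
  obtain ⟨𝔔, w, h𝔔, hw, h𝔔w⟩ := exists_place_comap_eq_smul (M := M) h𝔓₀ 1
  rw [one_smul] at h𝔔
  have hwv : w.under (𝓞 F) = v := HeightOneSpectrum.ext hw
  rcases placesOver_dichotomy_of_prime hl hunr with ⟨-, h1⟩ | ⟨hN, hf⟩
  · -- `f(w|v) = 1` would put `Φ` in `H`
    exfalso
    obtain ⟨τM, hτM⟩ := HeightOneSpectrum.exists_isArithFrobAt_of_mem_primesAbove_holds h𝔔w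
    have hres := isArithFrobAt_absGaloisRestrict_of_inertiaDeg_eq_one hw h𝔔w hτM (h1 w hwv)
    rw [h𝔔] at hres
    have hmem : Φ * (absGaloisRestrict F M τM)⁻¹ ∈ H := hI (hΦ.mul_inv_mem_inertia hres)
    apply hΦH
    have : Φ = Φ * (absGaloisRestrict F M τM)⁻¹ * absGaloisRestrict F M τM := by
      rw [inv_mul_cancel_right]
    rw [this]
    exact H.mul_mem hmem ⟨τM, rfl⟩
  · -- the inert case
    have huniq : ∀ w' : HeightOneSpectrum (𝓞 M), w'.under (𝓞 F) = v → w' = w := by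
      intro w' hw'
      haveI : Finite {w : HeightOneSpectrum (𝓞 M) // w.under (𝓞 F) = v} :=
        (finite_setOf_under_eq (M := M) v).to_subtype
      have hsub := (Nat.card_eq_one_iff_unique.mp hN).1
      exact congrArg Subtype.val (hsub.elim ⟨w', hw'⟩ ⟨w, hwv⟩)
    obtain ⟨τ, hτ⟩ : Φ ^ l ∈ H := by
      have h := Subgroup.pow_index_mem H Φ
      rwa [hHi] at h
    refine ⟨w, 𝔔, τ, hwv, huniq, hf w hwv, h𝔔w, h𝔔, ?_, hτ⟩
    refine isArithFrobAt_of_absGaloisRestrict_eq_pow hw h𝔔w (Φ := Φ) (by rw [h𝔔]; exact hΦ) ?_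
    rw [hf w hwv]
    exact hτ

end PrimeDegree

end Literature.NumberTheory.GaloisRepresentations
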